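import Mathlib

/-!
# The abelian-split census of the I-1 / I-1′ / I-3 models: the figures of `abelsplit.py` → `out-census.txt`, certified by `decide`
(p3 (g32), pub-hodge-repro0; PRIVATE STUDY 1, the study (i) of p3 (g31)'s CLOSING) — THE DEFINITIONS (the gate form: this file holds the definitions only;
the nine files `P3I3PluckerCensus<Model>` import it and carry one model each — its literals and its five theorems; the three
HOME files `P3I3PluckerCensusCert{I1,A4,S4}.lean` are the same definitions and theorems packaged three models per file)

Companion of `proofs/p3-scripts/i3-plucker/abelsplit.py` / `study.py census` → `out-census.txt` (p3 (g27); the (u) deposit of the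
Plücker page `proofs/P3-I3PluckerThreefold-v1.1.md`, STATUS l.11071), on the pattern of `P3I3ProdPointCert.lean` (permutation groups as
lists of images, closures by breadth-first steps with fuel, the transparent rank certificate) and of `P3I5BridgeCert.lean` (subsets as
BIT MASKS — the subset S of the n points is the number Σ_{s ∈ S} 2^s).  THE SETTING, the deposit's: A a CM abelian variety with embedding
set Σ = {0, …, n − 1}, the Galois-closure group G acting on Σ, ι ∈ G central, Φ a CM type (one of each ι-pair), M = span_ℚ{e_{hΦ} : h ∈ G}
(the character lattice of MT(A), dim MT(A) = rank of the rows e_{hΦ}); the character χ_S of a k-subset S restricts to MT(A) as its class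
mod M^⊥; the ℚ-Hodge structure V_S spanned by the G-orbit of S has Hodge numbers h^{p, k − p} = #{S′ ∈ G·S : |S′ ∩ Φ| = p}, LEVEL =
max p − min p; V_S is ABELIAN-SPLIT iff χ_{γS′} − χ_{S′} ∈ M^⊥ for every γ ∈ G′ = [G, G] and every S′ ∈ G·S; it is a HODGE-CLASS piece
iff |S′ ∩ Φ| = k/2 for every S′ in the orbit.  THE MODELS, typed from the deposit: I-1 (the generators of `model_I1` on the 8 points
of D and the 4 of C; its factor D alone = the restriction to the 8 points), I-1′ (the D₄ closure on 12 points, `study.py census`),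
I-3 in its two classes C₂ × A₄ / C₂ × S₄ (`model_I3a` / `model_I3b` on the 14 points of D × B; the factors D and B alone = the
restrictions) — NINE censuses.  THE CERTIFICATE, per model: (i) the group — G the listed group (closed under composition, containing
the identity and the typed generators, every element a product of generators: `closure` with fuel), G′ = the closure of the list of
ALL commutators (`commsOf` = the listed commutators, `closure` = the listed G′, closed), the inverses listed, G′ normal in G, ι central
and in G, Φ a CM type (ι swaps Φ and its complement), |Stab_G(Φ)| and its core, «G abelian» = (G′ = {1}), «ι ∈ G′»; (ii) dim MT(A) by
the transparent rank certificate on the rows e_{hΦ} (an invertible minor with its adjugate, every row a listed ℚ-combination of the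
basis rows `basis`) and dim M^⊥ = n − dim MT(A); (iii) THE CENSUS as an explicit list of orbit RECORDS (k, rep, size, level, Hodge
numbers, abelian-split, Hodge-class), the kernel verifying for every record that `rep` is CANONICAL (the least mask of its orbit),
that the records' reps are strictly increasing (pairwise distinct orbits), that the orbit sizes of the records with |rep| = k add up to
C(n, k) for every 1 ≤ k ≤ n − 1 (so the records exhaust the k-subsets: the census is COMPLETE), and every figure of every record; the
per-k figures of the printout (orbits / abelian-split / of which level ≥ 1 / Hodge-class pieces), the TOTAL and the number of
abelian-split pieces of level ≥ 1; (iv) the pieces the printout lists (by the deposit's own representatives, arbitrary orbit members)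
are exactly the records with abelian-split = true and level ≥ 1 (each printed rep carried to its canonical rep, all distinct).  THE
ABELIAN-SPLIT TEST as certified: |γS ∩ b| = |S ∩ b| for every γ ∈ G′ and every b in the listed BASIS of the rows e_{hΦ}, for the canonical
S only — exact for the deposit's test over all S′ ∈ G·S, all γ ∈ G′ and all h ∈ G because (a) orthogonality to a basis of M is
orthogonality to M (the rows are combinations of the basis rows, `rank_*`), (b) M is G-stable (the set {hΦ} is, `stable_*`) hence so is
M^⊥, and G′ is normal (`normal_*`): χ_{γgS} − χ_{gS} = g·(χ_{g⁻¹γg S} − χ_S) with g⁻¹γg ∈ G′ — the mirror `mirror.py` runs BOTH tests and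
finds them equal on every orbit.  Only finite combinatorics (ROUTE R-5; supporting, never load-bearing — R-17): the Hodge-theoretic
reading of every figure is the Plücker page's.  Nothing here asserts anything about whether the statement of README §1 has been
proved elsewhere.
-/

namespace HodgeRepro0.P3I3PluckerCensusDefs

/-! ### Permutations (lists of images), composition, inverses, commutators, the closure of generators -/

/-- a permutation of the n points as the list of its images -/
abbrev Perm := List Nat
/-- the image of a point -/
def app (g : Perm) (i : Nat) : Nat := g.getD i i
/-- the composite (g · h)(x) = g(h(x)) on n points (the deposit's `pmul`) -/
def comp (n : Nat) (g h : Perm) : Perm := (List.range n).map (fun i => app g (app h i))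
/-- the commutator a · b · a⁻¹ · b⁻¹, with the inverses given -/
def commWith (n : Nat) (a b ai bi : Perm) : Perm := comp n (comp n a b) (comp n ai bi)
/-- the restriction to the first m points -/
def restr (m : Nat) (g : Perm) : Perm := (List.range m).map (app g)
/-- the restriction to the points m, …, m + l − 1, renumbered 0, …, l − 1 -/
def restrFrom (m l : Nat) (g : Perm) : Perm := (List.range l).map (fun i => app g (i + m) - m)
/-- one breadth-first step: add the products s · g of the generators with the frontier -/
def closureStep (n : Nat) (gens : List Perm) (acc : List Perm × List Perm) : List Perm × List Perm :=
  let new := (acc.2.flatMap (fun g => gens.map (fun s => comp n s g))).filter (fun h => !acc.1.contains h)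
  let new' := new.eraseDups
  (acc.1 ++ new', new')
/-- the closure of the generators by `fuel` breadth-first steps (products of at most `fuel` generators, in breadth-first order) -/
def closure (n : Nat) (gens : List Perm) (fuel : Nat) : List Perm :=
  ((List.range fuel).foldl (fun acc _ => closureStep n gens acc) ([List.range n], [List.range n])).1
/-- G is a group: no repetition, the identity, closed under composition -/
def isGroup (n : Nat) (G : List Perm) : Bool :=
  G.eraseDups.length == G.length && G.contains (List.range n) && G.all (fun a => G.all (fun b => G.contains (comp n a b)))
/-- G ⊇ ⟨gens⟩: no repetition, the identity, closed under left multiplication by every generator (so every product of generators is in G) -/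
def genClosed (n : Nat) (gens G : List Perm) : Bool :=
  G.eraseDups.length == G.length && G.contains (List.range n) && gens.all (fun s => G.all (fun g => G.contains (comp n s g)))
/-- the inverses listed: g · ginv = 1 for the parallel lists -/
def inversesOf (n : Nat) (G Ginv : List Perm) : Bool :=
  G.length == Ginv.length && (G.zip Ginv).all (fun p => comp n p.1 p.2 == List.range n)
/-- every commutator of G is in the list `comms`, and every entry of `comms` is the commutator of the listed pair of indices -/
def commsCert (n : Nat) (G Ginv comms : List Perm) (wit : List (Nat × Nat)) : Bool :=
  (G.zip Ginv).all (fun a => (G.zip Ginv).all (fun b => comms.contains (commWith n a.1 b.1 a.2 b.2))) &&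
  comms.length == wit.length && (comms.zip wit).all (fun p => commWith n (G.getD p.2.1 []) (G.getD p.2.2 []) (Ginv.getD p.2.1 []) (Ginv.getD p.2.2 []) == p.1)

/-! ### Subsets as bit masks, the action, orbits, canonical representatives -/

/-- strictly increasing -/
def strictIncP : List Nat → Bool | a :: b :: t => a < b && strictIncP (b :: t) | _ => true
/-- strictly increasing (the reps of the records: pairwise distinct canonical representatives) -/
def strictInc (L : List Nat) : Bool := strictIncP L

/-- the mask of the point x -/
def bit (x : Nat) : Nat := 1 <<< x
/-- x ∈ S -/
def mem (S x : Nat) : Bool := (S >>> x) &&& 1 == 1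
/-- the image mask g(S) -/
def act (n : Nat) (g : Perm) (S : Nat) : Nat := (List.range n).foldl (fun acc x => if mem S x then acc ||| bit (app g x) else acc) 0
/-- |S| on the n points -/
def popcount (n : Nat) (S : Nat) : Nat := ((List.range n).filter (mem S)).length
/-- the orbit G · S as a list without repetition -/
def orbitList (n : Nat) (G : List Perm) (S : Nat) : List Nat := (G.map (fun g => act n g S)).eraseDups
/-- the least mask of the orbit (the canonical representative) -/
def orbitMin (n : Nat) (G : List Perm) (S : Nat) : Nat := (G.map (fun g => act n g S)).foldl min S
/-- the maximum of a list (0 if empty) -/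
def maxL : List Nat → Nat | [] => 0 | x :: t => max x (maxL t)
/-- the minimum of a non-empty list (0 if empty) -/
def minL : List Nat → Nat | [] => 0 | [x] => x | x :: t => min x (minL t)
/-- the Φ-counts |S′ ∩ Φ| over a list of masks -/
def pcounts (n : Nat) (Φ : Nat) (orb : List Nat) : List Nat := orb.map (fun T => popcount n (T &&& Φ))
/-- the Hodge numbers `hodge` are exactly the counts of the Φ-counts `ps`: every listed (p, c) exact, the counts summing to |ps|, p strictly increasing -/
def hodgeCheck (ps : List Nat) (hodge : List (Nat × Nat)) : Bool :=
  hodge.all (fun pc => (ps.filter (fun q => q == pc.1)).length == pc.2) && (hodge.map (fun pc => pc.2)).foldl (· + ·) 0 == ps.length && strictIncP (hodge.map (fun pc => pc.1))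
/-- the abelian-split test as certified: |γS ∩ b| = |S ∩ b| for every γ ∈ G′ and every basis row b -/
def splitOf (n : Nat) (Gp : List Perm) (Bm : List Nat) (S : Nat) : Bool :=
  Gp.all (fun γ => Bm.all (fun b => popcount n (act n γ S &&& b) == popcount n (S &&& b)))

/-- one orbit record of the census: the weight k, the canonical representative (a mask), the orbit size, the level, the Hodge numbers as (p, count), abelian-split, Hodge-class -/
structure Rec where
  k : Nat
  rep : Nat
  size : Nat
  level : Nat
  hodge : List (Nat × Nat)
  split : Bool
  hodgeclass : Bool
/-- every figure of a record against its orbit `orb` (= G · rep, computed once) and the Φ-counts `ps` over it -/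
def checkOrbit (n : Nat) (Gp : List Perm) (Φ : Nat) (Bm : List Nat) (r : Rec) (orb ps : List Nat) : Bool :=
  popcount n r.rep == r.k && orb.foldl min r.rep == r.rep && orb.length == r.size &&
  maxL ps - minL ps == r.level && hodgeCheck ps r.hodge &&
  splitOf n Gp Bm r.rep == r.split && (r.level == 0 && 2 * popcount n (r.rep &&& Φ) == r.k) == r.hodgeclass
/-- every figure of a record, against the definitions -/
def checkRec (n : Nat) (G Gp : List Perm) (Φ : Nat) (Bm : List Nat) (r : Rec) : Bool :=
  checkOrbit n Gp Φ Bm r (orbitList n G r.rep) (pcounts n Φ (orbitList n G r.rep))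
/-- the per-k figures: orbits, abelian-split, of which level ≥ 1, Hodge-class pieces -/
def figures (recs : List Rec) (k : Nat) : Nat × Nat × Nat × Nat :=
  let rk := recs.filter (fun r => r.k == k)
  (rk.length, (rk.filter (fun r => r.split)).length, (rk.filter (fun r => r.split && r.level ≥ 1)).length, (rk.filter (fun r => r.hodgeclass)).length)
/-- the orbit sizes of the records of weight k, summed -/
def sizeSum (recs : List Rec) (k : Nat) : Nat := ((recs.filter (fun r => r.k == k)).map (fun r => r.size)).foldl (· + ·) 0
/-- the reps of the abelian-split records of level ≥ 1 -/
def posReps (recs : List Rec) : List Nat := (recs.filter (fun r => r.split && r.level ≥ 1)).map (fun r => r.rep)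
/-- the whole census check: every record, the reps strictly increasing, the sizes summing to C(n, k) for k = 1, …, n − 1 -/
def censusCert (n : Nat) (G Gp : List Perm) (Φ : Nat) (Bm : List Nat) (recs : List Rec) (binom : List Nat) : Bool :=
  recs.all (checkRec n G Gp Φ Bm) && strictInc (recs.map (fun r => r.rep)) && (List.range' 1 (n - 1)).map (sizeSum recs) == binom
/-- the printed pieces (the deposit's representatives) are exactly the positive records: each canonical rep among them, all distinct, the counts equal -/
def piecesCert (n : Nat) (G : List Perm) (recs : List Rec) (printed : List Nat) : Bool :=
  printed.length == (posReps recs).length && (printed.map (orbitMin n G)).eraseDups.length == printed.length &&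
  printed.all (fun S => (posReps recs).contains (orbitMin n G S))

/-! ### The rank certificate (as in P3I3ProdPointCert / P3I5StructCert) -/

/-- the rows e_{hΦ} as 0/1 vectors of length n, h ∈ G -/
def rowsOf (n : Nat) (G : List Perm) (Φ : Nat) : List (List Int) :=
  G.map (fun g => (List.range n).map (fun x => if mem (act n g Φ) x then 1 else 0))
/-- the minor of the rows `bs` on the columns `cols` -/
def minorOf (R : List (List Int)) (bs cols : List Nat) : List (List Int) := bs.map (fun b => cols.map (fun j => (R.getD b []).getD j 0))
/-- the matrix product -/
def matmul (A B : List (List Int)) : List (List Int) :=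
  A.map (fun r => (List.range (B.headD []).length).map (fun j => (r.zip B).foldl (fun acc p => acc + p.1 * (p.2.getD j 0)) 0))
/-- d · I_n -/
def scalarId (n : Nat) (d : Int) : List (List Int) := (List.range n).map (fun i => (List.range n).map (fun j => if i == j then d else 0))
/-- M · N = d · I with d ≠ 0: M is invertible over ℚ -/
def invCert (M N : List (List Int)) (d : Int) : Bool := (d != 0) && decide (matmul M N = scalarId M.length d)
/-- the sum of two integer vectors -/
def vadd (u v : List Int) : List Int := (u.zip v).map (fun p => p.1 + p.2)
/-- the scalar multiple of an integer vector -/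
def vsmul (c : Int) (v : List Int) : List Int := v.map (fun x => c * x)
/-- every row of R is a listed ℚ-combination of the rows `bs`: d_g · row g = Σ c_i · row b_i with d_g ≠ 0 -/
def spanCert (n : Nat) (R : List (List Int)) (bs : List Nat) (coef : List (Int × List Int)) : Bool :=
  (coef.length == R.length) && ((List.range R.length).zip coef).all (fun gc =>
    (gc.2.1 != 0) && decide (vsmul gc.2.1 (R.getD gc.1 []) =
      (gc.2.2.zip bs).foldl (fun acc cb => vadd acc (vsmul cb.1 (R.getD cb.2 []))) (List.replicate n 0)))
/-- the rank of R is exactly |bs|: the minor on (bs, cols) invertible (rank ≥ |bs|) and every row a combination of the rows bs (rank ≤ |bs|) -/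
def rankCert (n : Nat) (R : List (List Int)) (bs cols : List Nat) (N : List (List Int)) (d : Int) (coef : List (Int × List Int)) : Bool :=
  (bs.length == cols.length) && invCert (minorOf R bs cols) N d && spanCert n R bs coef

/-! ### Group-level figures -/

/-- the stabiliser of Φ in G -/
def stabOf (n : Nat) (G : List Perm) (Φ : Nat) : List Perm := G.filter (fun g => act n g Φ == Φ)
/-- its core: the elements h of the stabiliser with g⁻¹ h g in the stabiliser for every g -/
def coreOf (n : Nat) (G Ginv : List Perm) (Φ : Nat) : List Perm :=
  (stabOf n G Φ).filter (fun h => (G.zip Ginv).all (fun p => (stabOf n G Φ).contains (comp n (comp n p.2 h) p.1)))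
/-- ι central in G, in G, and Φ a CM type for it: ι(Φ) is the complement of Φ in the n points -/
def cmType (n : Nat) (G : List Perm) (ι : Perm) (Φ : Nat) : Bool :=
  G.contains ι && G.all (fun g => comp n ι g == comp n g ι) && popcount n Φ * 2 == n && (act n ι Φ &&& Φ == 0) && (act n ι Φ ||| Φ == (1 <<< n) - 1)
/-- G′ normal in G: g⁻¹ γ g ∈ G′ -/
def normalIn (n : Nat) (G Ginv Gp : List Perm) : Bool := (G.zip Ginv).all (fun p => Gp.all (fun γ => Gp.contains (comp n (comp n p.2 γ) p.1)))
/-- the set GΦ = {hΦ : h ∈ G} (listed) is G-stable (so M and M^⊥ are) -/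
def stableSet (n : Nat) (G : List Perm) (Φ : Nat) (GPhi : List Nat) : Bool :=
  G.map (fun h => act n h Φ) == GPhi && GPhi.all (fun m => G.all (fun g => GPhi.contains (act n g m)))

end HodgeRepro0.P3I3PluckerCensusDefs
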